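/-
Copyright (c) 2026 the pub-hodgecm-mathlib formalisation cell (harness21).  Prover seat hodgecm-mathlib-A-p12 (g23), 2026-09-01.  «S3-ram» seeding wave (LEAD F0P3a-plan (g12)
T11-62; owner F0P3a-p06 (g15)): organ «T6-2r ∕ H²-ram», `H_v`-level — the two H-columns of STUB B₂ of the P-2-ram skeleton (α₂) on the TYPE-(2) population at a tame-ramified place.
-/
import Literature.NumberTheory.Automorphic.UnitaryTwoRamifiedDeepFixedEdgesVertices        -- ★ (this seat): `#Fix(U₂⧸K⁰) + 1 = #Fix(U₂⧸K♯)` for deep regular elliptic `γ`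
import Literature.NumberTheory.Automorphic.UnitaryTwoRamifiedEllipticFixedModularVertices    -- ★ p847070 (this seat): the `K♯`-column on the one-place model `U_w`, `(q−1)·# + 2 = (q+1)qⁿ ∕ 2q^(n+1)`
import Literature.NumberTheory.Rogawski1990.DepthZeroTransferHValuesTypeTwoChi               -- ★ F0P2-p06: `sq_redMat_sub_one_eq_zero_of_isLocalStablyConjH_of_trace_of_det` (deep ⇒ residually unipotent on the stable orbit)
import Literature.NumberTheory.Automorphic.UnitaryTwoResiduallyUnipotentTrivialRamified       -- ★ p846905 (F0P2-p06): `redMat_eq_one_of_sq_sub_one_eq_zero_of_ramified` (⇒ residually trivial at a ramified `w`)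
import Literature.NumberTheory.Rogawski1990.UnitStableOrbitalIntegralIrredOneClass           -- ★ one class: `stableOrbitalIntegralRel_eq_classOrbitalIntegral_of_not_exists_isRoot`
import Literature.NumberTheory.Automorphic.UnitOrbitalIntegralFixedPointsVolume               -- ★ B-p04 (g34): `classOrbitalIntegral_indicator_complex_eq_natCard_fixedBy_mul` (any compact open `C`, mass `ν(C)`)
import Literature.NumberTheory.Automorphic.UnitaryTypeTwoNormPairCentralizerCompactRamified  -- ★ (this lineage, g22): `compactSpace_centralizer_endoPair_of_not_exists_isRoot_nonsplit`
import Literature.NumberTheory.Automorphic.UnitaryUnitOrbitalIntegralLatticeCount            -- ★ `natCard_fixedBy_quotient_congr` (transport of fixed cosets along `E₂`)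
import Literature.NumberTheory.Rogawski1990.LocalStableOrbitalIntegralGlue                   -- ★ `stableOrbitalIntegralRel_congr_fun_of_eqOn`
import Literature.NumberTheory.Rogawski1990.UnitFundamentalLemmaInertLeviClause              -- ★ `isLocalGRegular_conj_iff`
import Literature.NumberTheory.Rogawski1990.LocalCentralizerTorusMeasureCM                   -- ★ `isRegularElt_fst_snd_of_isLocalGRegular`
import Literature.NumberTheory.Rogawski1990.RankOneKappaOrbitalShellDressTorus               -- ★ `finite_residueField_integer_adicCompletion`, `natCard_residueField_integer_adicCompletion_eq` (`q` currency)
import Literature.GroupTheory.CosetSpaceProdTop                                              -- ★ A-p16: `natCard_fixedBy_quotient_prod_top_eq` (the compact factor `U₁`)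
import HarnessLib

/-!
# The H-side values of STUB B₂ (type (2), tame-ramified place): `Φ^st(γ_H, χ♯) = ν_H(K♯ × U₁)·#Fix(U₂⧸K♯)`, `Φ^st(γ_H, χ⁰) = ν_H(K_H)·#Fix(U₂⧸K⁰)`, `#Fix(U₂⧸K⁰) + 1 = #Fix(U₂⧸K♯)`,
# `(q − 1)·#Fix(U₂⧸K♯) + 2 = (q + 1)qⁿ` (depth `2n`) ∕ `2q^(n+1)` (depth `2n + 1`)   (Rogawski 1990 §4.9; Labesse–Langlands 1979 §2; Kottwitz 1988 §2)

Topic `NumberTheory/Rogawski1990`; namespace `Literature.NumberTheory.Automorphic.UnitaryGroup` (as the inert twin ★ `DepthZeroTransferHValuesTypeTwo`).  THEOREMS ONLY (no definition,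
no instance, no notation, no named fact, no `sorry`); kernel lane `--supports stmt-HodgeConjecture-24833`.  Cell `pub/hodgecm-mathlib` (D-0151), crux H413; «S3-ram» seeding wave
(LEAD F0P3a-plan (g12) T11-62; owner F0P3a-p06 (g15)); seat A-p12 (g23).  Organ «T6-2r ∕ H²-ram» = the H-side of STUB B₂ `stub_typeTwo_HSideProfiles_ram` of the P-2-ram skeleton
(α₂) v0.4 (`F0/P3a/A-p12/g23/DepthZeroKappaTransferTypeTwoRamified.skeleton.v4.A-p12g23.lean`, 6c8f4919): on the TYPE-(2) population (`χ_{γ₂,w}` without root in `L_w`) the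
stable class is ONE `H_v`-class (★ `…_of_not_exists_isRoot`), `Z_{H_v}(γ_H)` is compact (★ g22), and the stable orbital integral of the indicator of a compact open `K′ × U₁` is
`ν_H(K′ × U₁)·#Fix_{γ₂}(U₂ ⧸ K′)` (★ B-p04's mass-carrying unfolding + ★ A-p16's product lemma).  HONEST LABEL: HC_CM is proved only modulo the cell's 2 remaining named inputs
(hLiu418 24832, h413 24833) until rung 0 closes; this file is an assembly over ★ material and asserts nothing printed.

THE TWO COLUMNS (`ψ^ram = ![χ⁰, χ♯]`, END's fold v6 :118; `K_H = K⁰ × U₁`, `K⁰ = U₂ ∩ GL₂(𝒪_w)` the self-dual EDGE stabiliser, `K♯ = U₂ ∩ D_ϖ GL₂(𝒪_w) D_ϖ⁻¹` the `ϖ`-MODULAR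
VERTEX stabiliser of the tree of `SL₂(L⁺_v)` — [Tits1979, §3.9]):
* `χ♯ = 1_{K♯ × U₁}` — the skeleton's set `{h | ∀ a b, |ϖ^b ϖ^{−a} (E₂ h.1)_{ab}|_w ≤ 1}` IS `K♯ × U₁` (★ F0P3a-p04 `forall_v_sharp_iff_coe_mem_map_conj`): §1
  `stableOrbitalIntegralRel_indicator_prod_top_eq_mul_natCard_fixedBy_of_not_exists_isRoot` (any compact open `C ≤ U₂`), `…_indicator_sharp_…` (the skeleton's set).
* `χ⁰ = 1_{K_H}·[(h̄ − 1)² = 0 ∧ rank(h̄ − 1) = 0]` — on the stable orbit of a DEEP `γ_H` (`|tr γ_{2,w} − 2|_w, |det γ_{2,w} − 1|_w < 1`) every `K_H`-point is residually unipotent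
  (★ `sq_redMat_sub_one_eq_zero_of_isLocalStablyConjH_of_trace_of_det`), hence residually TRIVIAL at a ramified `w` (★ p846905), so `χ⁰ = 1_{K_H}` there (★
  `stableOrbitalIntegralRel_congr_fun_of_eqOn`): §2 `stableOrbitalIntegralRel_chiZero_eq_mul_natCard_fixedBy_of_not_exists_isRoot_of_deep_ramified`.
* the COUNTS: §3 `natCard_fixedBy_eq_ncard_fixedBy_onePlace` (transport to `U_w` along `E₂`, ★ `natCard_fixedBy_quotient_congr`), then ★ p847070's two heads read on `U₂`
  (`sub_one_mul_natCard_fixedBy_add_two_eq_of_unramified_elliptic ∕ _of_ramified_elliptic`, `q = #(𝓞_{L⁺} ∕ v)`), and ★ `natCard_fixedBy_add_one_eq_natCard_fixedBy_of_deep_of_ramified`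
  for the `K⁰`-column.  Values (B-p14 (g38) certificate «P-2-ram profiles» b8cfb164): `(#K⁰, #K♯) = ((q+1)T, 1 + (q+1)T)`, `T = Σ_{k<n} q^k`, at depth `2n`;
  `(2S − 1, 2S)`, `S = Σ_{k≤n} q^k`, at depth `2n + 1`.  The parity∕descent dictionary `|tr² − 4 det|_w = exp(−2N) ↦ (ε₀ z², π₁ z²)` is ★ p847095 `UnitaryTwoDescentDiscriminantRamified`.

## References
* [Rogawski1990] J. D. Rogawski, *Automorphic Representations of Unitary Groups in Three Variables*, Ann. of Math. Stud. 123 (1990): §4.9 Lemma 4.9.3 p. 56, Prop. 4.9.1 (b) p. 55;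
  §4.3 (4.3.1) p. 43; §3.6 p. 31.
* [LabesseLanglands1979] J.-P. Labesse, R. P. Langlands, *L-indistinguishability for SL(2)*, Canad. J. Math. 31 (1979): §2 Lemma 2.1 p. 8 (fixed balls of elliptic tori).
* [Kottwitz1988] R. E. Kottwitz, *Tamagawa numbers*, Ann. of Math. 127 (1988): §2 (orbital integrals of indicators as fixed-coset counts).
* [Tits1979] J. Tits, *Reductive groups over local fields*, PSPM 33.1 (1979): §3.9 (ramified quasi-split `U(2)`: vertex and edge stabilisers).
-/

set_option autoImplicit false

noncomputable section

open MeasureTheory Measure Set NumberField IsDedekindDomain Matrix ValuativeRel MulAction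
open scoped ENNReal NNReal ValuativeRel Matrix MatrixGroups WithZero

namespace Literature.NumberTheory.Automorphic.UnitaryGroup

open Literature.NumberTheory.Rogawski1990 Literature.NumberTheory.Automorphic Literature.NumberTheory.Automorphic.IntegralReduction
open Literature.NumberTheory.Automorphic.HermitianLatticeTree Literature.GroupTheory

section HValues

variable (L : Type) [Field L] [NumberField L] [IsCMField L] (v : HeightOneSpectrum (𝓞 ↥(maximalRealSubfield L)))
  (w : PlacesOver L v) (hw : IsCMField.complexConj L • w.1 = w.1)
  [MeasurableSpace ((cmDatum L 2 (Matrix.of fun i j : Fin 2 => if i.val + j.val + 1 = 2 then (1 : L) else 0)).Local v × (cmDatum L 1 (Matrix.of fun i j : Fin 1 => if i.val + j.val + 1 = 1 then (1 : L) else 0)).Local v)] [BorelSpace ((cmDatum L 2 (Matrix.of fun i j : Fin 2 => if i.val + j.val + 1 = 2 then (1 : L) else 0)).Local v × (cmDatum L 1 (Matrix.of fun i j : Fin 1 => if i.val + j.val + 1 = 1 then (1 : L) else 0)).Local v)]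
  [∀ a : ((cmDatum L 2 (Matrix.of fun i j : Fin 2 => if i.val + j.val + 1 = 2 then (1 : L) else 0)).Local v × (cmDatum L 1 (Matrix.of fun i j : Fin 1 => if i.val + j.val + 1 = 1 then (1 : L) else 0)).Local v), MeasurableSpace (((cmDatum L 2 (Matrix.of fun i j : Fin 2 => if i.val + j.val + 1 = 2 then (1 : L) else 0)).Local v × (cmDatum L 1 (Matrix.of fun i j : Fin 1 => if i.val + j.val + 1 = 1 then (1 : L) else 0)).Local v) ⧸ Subgroup.centralizer ({a} : Set ((cmDatum L 2 (Matrix.of fun i j : Fin 2 => if i.val + j.val + 1 = 2 then (1 : L) else 0)).Local v × (cmDatum L 1 (Matrix.of fun i j : Fin 1 => if i.val + j.val + 1 = 1 then (1 : L) else 0)).Local v)))]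
  [∀ a : ((cmDatum L 2 (Matrix.of fun i j : Fin 2 => if i.val + j.val + 1 = 2 then (1 : L) else 0)).Local v × (cmDatum L 1 (Matrix.of fun i j : Fin 1 => if i.val + j.val + 1 = 1 then (1 : L) else 0)).Local v), BorelSpace (((cmDatum L 2 (Matrix.of fun i j : Fin 2 => if i.val + j.val + 1 = 2 then (1 : L) else 0)).Local v × (cmDatum L 1 (Matrix.of fun i j : Fin 1 => if i.val + j.val + 1 = 1 then (1 : L) else 0)).Local v) ⧸ Subgroup.centralizer ({a} : Set ((cmDatum L 2 (Matrix.of fun i j : Fin 2 => if i.val + j.val + 1 = 2 then (1 : L) else 0)).Local v × (cmDatum L 1 (Matrix.of fun i j : Fin 1 => if i.val + j.val + 1 = 1 then (1 : L) else 0)).Local v)))]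
  (νH : Measure ((cmDatum L 2 (Matrix.of fun i j : Fin 2 => if i.val + j.val + 1 = 2 then (1 : L) else 0)).Local v × (cmDatum L 1 (Matrix.of fun i j : Fin 1 => if i.val + j.val + 1 = 1 then (1 : L) else 0)).Local v)) [νH.IsHaarMeasure] [νH.IsMulRightInvariant]

/-! ## §1 The indicator of `C × U₁` for a compact open `C ≤ U₂`; the `χ♯` column -/

set_option maxHeartbeats 400000 in
include hw in
/-- **`Φ^st(γ_H, 1_{C × U₁}) = ν_H(C × U₁) · #Fix_{γ₂}(U₂ ⧸ C)`** for a `G`-regular TYPE-(2) `γ_H = (γ₂, γ₁)` (`χ_{γ₂,w}` without root in `L_w`) and ANY compact open subgroup `C ≤ U₂`,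
any Haar measure `ν_H`: one class (★ `…_of_not_exists_isRoot`), compact centraliser (★ `compactSpace_centralizer_endoPair_of_not_exists_isRoot_nonsplit`), the mass-carrying
unfolding (★ `classOrbitalIntegral_indicator_complex_eq_natCard_fixedBy_mul`) and the compact factor `U₁` (★ `natCard_fixedBy_quotient_prod_top_eq`).
[cite: Rogawski1990, §4.9 Prop. 4.9.1 (b) p. 55; §4.3 (4.3.1) p. 43] [cite: Kottwitz1988, §2] -/
theorem stableOrbitalIntegralRel_indicator_prod_top_eq_mul_natCard_fixedBy_of_not_exists_isRoot
    {mH : OrbitalMeasureFamily ((cmDatum L 2 (Matrix.of fun i j : Fin 2 => if i.val + j.val + 1 = 2 then (1 : L) else 0)).Local v × (cmDatum L 1 (Matrix.of fun i j : Fin 1 => if i.val + j.val + 1 = 1 then (1 : L) else 0)).Local v)} (hmH : mH.IsCanonical (IsLocalGRegular L v) νH)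
    (C : Subgroup ((cmDatum L 2 (Matrix.of fun i j : Fin 2 => if i.val + j.val + 1 = 2 then (1 : L) else 0)).Local v)) (hCo : IsOpen (C : Set ((cmDatum L 2 (Matrix.of fun i j : Fin 2 => if i.val + j.val + 1 = 2 then (1 : L) else 0)).Local v))) (hCc : IsCompact (C : Set ((cmDatum L 2 (Matrix.of fun i j : Fin 2 => if i.val + j.val + 1 = 2 then (1 : L) else 0)).Local v)))
    {γH : ((cmDatum L 2 (Matrix.of fun i j : Fin 2 => if i.val + j.val + 1 = 2 then (1 : L) else 0)).Local v × (cmDatum L 1 (Matrix.of fun i j : Fin 1 => if i.val + j.val + 1 = 1 then (1 : L) else 0)).Local v)} (hreg : IsLocalGRegular L v γH)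
    (hirr : ¬ ∃ x : (w.1.adicCompletion L), ((((γH.1.val : GL (Fin 2) (UnitaryGroup.LocalRing L v)).val.map (Pi.evalRingHom (fun w' : PlacesOver L v => w'.1.adicCompletion L) w))).charpoly).IsRoot x) :
    stableOrbitalIntegralRel (IsLocalStablyConjH L v) mH (((C.prod (⊤ : Subgroup ((cmDatum L 1 (Matrix.of fun i j : Fin 1 => if i.val + j.val + 1 = 1 then (1 : L) else 0)).Local v)) : Subgroup ((cmDatum L 2 (Matrix.of fun i j : Fin 2 => if i.val + j.val + 1 = 2 then (1 : L) else 0)).Local v × (cmDatum L 1 (Matrix.of fun i j : Fin 1 => if i.val + j.val + 1 = 1 then (1 : L) else 0)).Local v)) : Set ((cmDatum L 2 (Matrix.of fun i j : Fin 2 => if i.val + j.val + 1 = 2 then (1 : L) else 0)).Local v × (cmDatum L 1 (Matrix.of fun i j : Fin 1 => if i.val + j.val + 1 = 1 then (1 : L) else 0)).Local v)).indicator fun _ => (1 : ℂ)) γH =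
      (νH.real ((C.prod (⊤ : Subgroup ((cmDatum L 1 (Matrix.of fun i j : Fin 1 => if i.val + j.val + 1 = 1 then (1 : L) else 0)).Local v)) : Subgroup ((cmDatum L 2 (Matrix.of fun i j : Fin 2 => if i.val + j.val + 1 = 2 then (1 : L) else 0)).Local v × (cmDatum L 1 (Matrix.of fun i j : Fin 1 => if i.val + j.val + 1 = 1 then (1 : L) else 0)).Local v)) : Set ((cmDatum L 2 (Matrix.of fun i j : Fin 2 => if i.val + j.val + 1 = 2 then (1 : L) else 0)).Local v × (cmDatum L 1 (Matrix.of fun i j : Fin 1 => if i.val + j.val + 1 = 1 then (1 : L) else 0)).Local v)) : ℂ) * (Nat.card (fixedBy (((cmDatum L 2 (Matrix.of fun i j : Fin 2 => if i.val + j.val + 1 = 2 then (1 : L) else 0)).Local v) ⧸ C) γH.1) : ℂ) := by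
  haveI := compactSpace_centralizer_endoPair_of_not_exists_isRoot_nonsplit L v w hw γH hirr
  haveI : CompactSpace ((cmDatum L 1 (Matrix.of fun i j : Fin 1 => if i.val + j.val + 1 = 1 then (1 : L) else 0)).Local v) := compactSpace_cmDatum_local_one_of_smul_eq L (Matrix.of fun i j : Fin 1 => if i.val + j.val + 1 = 1 then (1 : L) else 0) w hw (isUnit_placeForm_antidiagOne (E := L) 1 w.1)
  have hopen : IsOpen ((C.prod (⊤ : Subgroup ((cmDatum L 1 (Matrix.of fun i j : Fin 1 => if i.val + j.val + 1 = 1 then (1 : L) else 0)).Local v)) : Subgroup ((cmDatum L 2 (Matrix.of fun i j : Fin 2 => if i.val + j.val + 1 = 2 then (1 : L) else 0)).Local v × (cmDatum L 1 (Matrix.of fun i j : Fin 1 => if i.val + j.val + 1 = 1 then (1 : L) else 0)).Local v)) : Set ((cmDatum L 2 (Matrix.of fun i j : Fin 2 => if i.val + j.val + 1 = 2 then (1 : L) else 0)).Local v × (cmDatum L 1 (Matrix.of fun i j : Fin 1 => if i.val + j.val + 1 = 1 then (1 : L) else 0)).Local v)) := by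
    rw [Subgroup.coe_prod, Subgroup.coe_top]; exact hCo.prod isOpen_univ
  have hcpt : IsCompact ((C.prod (⊤ : Subgroup ((cmDatum L 1 (Matrix.of fun i j : Fin 1 => if i.val + j.val + 1 = 1 then (1 : L) else 0)).Local v)) : Subgroup ((cmDatum L 2 (Matrix.of fun i j : Fin 2 => if i.val + j.val + 1 = 2 then (1 : L) else 0)).Local v × (cmDatum L 1 (Matrix.of fun i j : Fin 1 => if i.val + j.val + 1 = 1 then (1 : L) else 0)).Local v)) : Set ((cmDatum L 2 (Matrix.of fun i j : Fin 2 => if i.val + j.val + 1 = 2 then (1 : L) else 0)).Local v × (cmDatum L 1 (Matrix.of fun i j : Fin 1 => if i.val + j.val + 1 = 1 then (1 : L) else 0)).Local v)) := by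
    rw [Subgroup.coe_prod, Subgroup.coe_top]; exact hCc.prod isCompact_univ
  have hprod := natCard_fixedBy_quotient_prod_top_eq (A := ((cmDatum L 1 (Matrix.of fun i j : Fin 1 => if i.val + j.val + 1 = 1 then (1 : L) else 0)).Local v)) C γH.1 γH.2
  rw [Prod.mk.eta] at hprod
  rw [stableOrbitalIntegralRel_eq_classOrbitalIntegral_of_not_exists_isRoot L v w hw mH _ hirr,
    classOrbitalIntegral_indicator_complex_eq_natCard_fixedBy_mul (P := IsLocalGRegular L v) (fun g x hg => (isLocalGRegular_conj_iff L x g).2 hg) hmH hreg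
      (C.prod (⊤ : Subgroup ((cmDatum L 1 (Matrix.of fun i j : Fin 1 => if i.val + j.val + 1 = 1 then (1 : L) else 0)).Local v))) hopen hcpt (isClosed_conjClass_localH_of_isLocalGRegular L v γH hreg),
    hprod, measureReal_def, mul_comm]

set_option maxHeartbeats 400000 in
include hw in
/-- **THE `χ♯` COLUMN: `Φ^st(γ_H, χ♯) = ν_H(K♯ × U₁) · #Fix_{γ₂}(U₂ ⧸ K♯)`** — the skeleton's set `{h | ∀ a b, |ϖ^b ϖ^{−a} (E₂ h.1)_{ab}|_w ≤ 1}` (fold v6 :118's `χ♯` token with the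
uniformiser `ϖ` as a unit) IS `C′ × U₁` for the subgroup `C′ ≤ U₂` matched by `E₂` with `D_ϖ GL₂(𝒪_w) D_ϖ⁻¹` (★ `forall_v_sharp_iff_coe_mem_map_conj`), so §1 applies.
[cite: Rogawski1990, §4.9 Lemma 4.9.3 p. 56, Prop. 4.9.1 (b) p. 55] [cite: Tits1979, §3.9] [cite: Kottwitz1988, §2] -/
theorem stableOrbitalIntegralRel_indicator_sharp_eq_mul_natCard_fixedBy_of_not_exists_isRoot
    {mH : OrbitalMeasureFamily ((cmDatum L 2 (Matrix.of fun i j : Fin 2 => if i.val + j.val + 1 = 2 then (1 : L) else 0)).Local v × (cmDatum L 1 (Matrix.of fun i j : Fin 1 => if i.val + j.val + 1 = 1 then (1 : L) else 0)).Local v)} (hmH : mH.IsCanonical (IsLocalGRegular L v) νH)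
    (ϖ : (w.1.adicCompletion L)ˣ) (C' : Subgroup ((cmDatum L 2 (Matrix.of fun i j : Fin 2 => if i.val + j.val + 1 = 2 then (1 : L) else 0)).Local v))
    (hC' : ∀ g, g ∈ C' ↔ (((localNonsplitEquiv (IsCMField.complexConj L) (Matrix.of fun i j : Fin 2 => if i.val + j.val + 1 = 2 then (1 : L) else 0) (IsCMField.complexConj_ne_one L) w hw) g : ↥(unitaryGroupOfForm (galAdicCompletionMap (L := L) (IsCMField.complexConj L) hw) (placeForm (Matrix.of fun i j : Fin 2 => if i.val + j.val + 1 = 2 then (1 : L) else 0) w.1))) : GL (Fin 2) (w.1.adicCompletion L)) ∈ (glInt 2 (w.1.adicCompletion L)).map (MulAut.conj (glDiagonal 2 (w.1.adicCompletion L) ![1, ϖ])).toMonoidHom)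
    (hC'o : IsOpen (C' : Set ((cmDatum L 2 (Matrix.of fun i j : Fin 2 => if i.val + j.val + 1 = 2 then (1 : L) else 0)).Local v))) (hC'c : IsCompact (C' : Set ((cmDatum L 2 (Matrix.of fun i j : Fin 2 => if i.val + j.val + 1 = 2 then (1 : L) else 0)).Local v)))
    {γH : ((cmDatum L 2 (Matrix.of fun i j : Fin 2 => if i.val + j.val + 1 = 2 then (1 : L) else 0)).Local v × (cmDatum L 1 (Matrix.of fun i j : Fin 1 => if i.val + j.val + 1 = 1 then (1 : L) else 0)).Local v)} (hreg : IsLocalGRegular L v γH)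
    (hirr : ¬ ∃ x : (w.1.adicCompletion L), ((((γH.1.val : GL (Fin 2) (UnitaryGroup.LocalRing L v)).val.map (Pi.evalRingHom (fun w' : PlacesOver L v => w'.1.adicCompletion L) w))).charpoly).IsRoot x) :
    stableOrbitalIntegralRel (IsLocalStablyConjH L v) mH
        (Set.indicator {h : ((cmDatum L 2 (Matrix.of fun i j : Fin 2 => if i.val + j.val + 1 = 2 then (1 : L) else 0)).Local v × (cmDatum L 1 (Matrix.of fun i j : Fin 1 => if i.val + j.val + 1 = 1 then (1 : L) else 0)).Local v) | ∀ a b : Fin 2, Valued.v ((ϖ : w.1.adicCompletion L) ^ (b : ℕ) * ((ϖ : w.1.adicCompletion L) ^ (a : ℕ))⁻¹ * ((((localNonsplitEquiv (IsCMField.complexConj L) (Matrix.of fun i j : Fin 2 => if i.val + j.val + 1 = 2 then (1 : L) else 0) (IsCMField.complexConj_ne_one L) w hw) h.1 : ↥(unitaryGroupOfForm (galAdicCompletionMap (L := L) (IsCMField.complexConj L) hw) (placeForm (Matrix.of fun i j : Fin 2 => if i.val + j.val + 1 = 2 then (1 : L) else 0) w.1))) : GL (Fin 2) (w.1.adicCompletion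 L)) : Matrix (Fin 2) (Fin 2) (w.1.adicCompletion L)) a b) ≤ 1}
          (fun _ => (1 : ℂ))) γH =
      (νH.real ((C'.prod (⊤ : Subgroup ((cmDatum L 1 (Matrix.of fun i j : Fin 1 => if i.val + j.val + 1 = 1 then (1 : L) else 0)).Local v)) : Subgroup ((cmDatum L 2 (Matrix.of fun i j : Fin 2 => if i.val + j.val + 1 = 2 then (1 : L) else 0)).Local v × (cmDatum L 1 (Matrix.of fun i j : Fin 1 => if i.val + j.val + 1 = 1 then (1 : L) else 0)).Local v)) : Set ((cmDatum L 2 (Matrix.of fun i j : Fin 2 => if i.val + j.val + 1 = 2 then (1 : L) else 0)).Local v × (cmDatum L 1 (Matrix.of fun i j : Fin 1 => if i.val + j.val + 1 = 1 then (1 : L) else 0)).Local v)) : ℂ) * (Nat.card (fixedBy (((cmDatum L 2 (Matrix.of fun i j : Fin 2 => if i.val + j.val + 1 = 2 then (1 : L) else 0)).Local v) ⧸ C') γH.1) : ℂ) := by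
  have hset : {h : ((cmDatum L 2 (Matrix.of fun i j : Fin 2 => if i.val + j.val + 1 = 2 then (1 : L) else 0)).Local v × (cmDatum L 1 (Matrix.of fun i j : Fin 1 => if i.val + j.val + 1 = 1 then (1 : L) else 0)).Local v) | ∀ a b : Fin 2, Valued.v ((ϖ : w.1.adicCompletion L) ^ (b : ℕ) * ((ϖ : w.1.adicCompletion L) ^ (a : ℕ))⁻¹ * ((((localNonsplitEquiv (IsCMField.complexConj L) (Matrix.of fun i j : Fin 2 => if i.val + j.val + 1 = 2 then (1 : L) else 0) (IsCMField.complexConj_ne_one L) w hw) h.1 : ↥(unitaryGroupOfForm (galAdicCompletionMap (L := L) (IsCMField.complexConj L) hw) (placeForm (Matrix.of fun i j : Fin 2 => if i.val + j.val + 1 = 2 then (1 : L) else 0) w.1))) : GL (Fin 2) (w.1.adicCompletion L)) : Matrix (Fin 2) (Fin 2) (w.1.adicCompletion L)) a b) ≤ 1} =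
      ((C'.prod (⊤ : Subgroup ((cmDatum L 1 (Matrix.of fun i j : Fin 1 => if i.val + j.val + 1 = 1 then (1 : L) else 0)).Local v)) : Subgroup ((cmDatum L 2 (Matrix.of fun i j : Fin 2 => if i.val + j.val + 1 = 2 then (1 : L) else 0)).Local v × (cmDatum L 1 (Matrix.of fun i j : Fin 1 => if i.val + j.val + 1 = 1 then (1 : L) else 0)).Local v)) : Set ((cmDatum L 2 (Matrix.of fun i j : Fin 2 => if i.val + j.val + 1 = 2 then (1 : L) else 0)).Local v × (cmDatum L 1 (Matrix.of fun i j : Fin 1 => if i.val + j.val + 1 = 1 then (1 : L) else 0)).Local v)) := by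
    ext h
    rw [Set.mem_setOf_eq, SetLike.mem_coe, Subgroup.mem_prod, hC' h.1, forall_v_sharp_iff_coe_mem_map_conj L w hw ϖ]
    simp only [Subgroup.mem_top, and_true]
  rw [hset]
  exact stableOrbitalIntegralRel_indicator_prod_top_eq_mul_natCard_fixedBy_of_not_exists_isRoot L v w hw νH hmH C' hC'o hC'c hreg hirr

/-! ## §2 The `χ⁰` column on the DEEP type-(2) population -/

set_option maxHeartbeats 400000 in
include hw in
/-- **THE `χ⁰` COLUMN: `Φ^st(γ_H, χ⁰) = ν_H(K_H) · #Fix_{γ₂}(U₂ ⧸ K⁰)`** for a `G`-regular type-(2) `γ_H` which is DEEP at `w` (`|tr γ_{2,w} − 2|_w < 1`, `|det γ_{2,w} − 1|_w < 1`), `w`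
tame-ramified (`e(w|v) ≠ 1`, `2 ∈ 𝒪_w^×`): END's `χ⁰ = 1_{K_H}·[(h̄_w − 1)² = 0 ∧ rank(h̄_w − 1) = 0]` coincides with `1_{K_H}` on the stable orbit (residually unipotent ★
`sq_redMat_sub_one_eq_zero_of_isLocalStablyConjH_of_trace_of_det`, hence residually trivial ★ `redMat_eq_one_of_sq_sub_one_eq_zero_of_ramified`), and `K_H = K⁰ × U₁` (★
`cmLocalIntegralLevel_one_eq_top_of_smul_eq`); then §1.  The `Decidable` instance of the `if` is the binder `χdec` (pass `_`).
[cite: Rogawski1990, §4.9 Lemma 4.9.3 p. 56, Prop. 4.9.1 (b) p. 55] [cite: Kottwitz1988, §2] -/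
theorem stableOrbitalIntegralRel_chiZero_eq_mul_natCard_fixedBy_of_not_exists_isRoot_of_deep_ramified
    (he : v.asIdeal.ramificationIdx' w.1.asIdeal ≠ 1) (h2 : IsUnit (2 : 𝒪[(w.1.adicCompletion L)]))
    {mH : OrbitalMeasureFamily ((cmDatum L 2 (Matrix.of fun i j : Fin 2 => if i.val + j.val + 1 = 2 then (1 : L) else 0)).Local v × (cmDatum L 1 (Matrix.of fun i j : Fin 1 => if i.val + j.val + 1 = 1 then (1 : L) else 0)).Local v)} (hmH : mH.IsCanonical (IsLocalGRegular L v) νH)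
    {γH : ((cmDatum L 2 (Matrix.of fun i j : Fin 2 => if i.val + j.val + 1 = 2 then (1 : L) else 0)).Local v × (cmDatum L 1 (Matrix.of fun i j : Fin 1 => if i.val + j.val + 1 = 1 then (1 : L) else 0)).Local v)} (hreg : IsLocalGRegular L v γH)
    (hirr : ¬ ∃ x : (w.1.adicCompletion L), ((((γH.1.val : GL (Fin 2) (UnitaryGroup.LocalRing L v)).val.map (Pi.evalRingHom (fun w' : PlacesOver L v => w'.1.adicCompletion L) w))).charpoly).IsRoot x)
    (htr : Valued.v ((((γH.1.val : GL (Fin 2) (UnitaryGroup.LocalRing L v)).val.map (Pi.evalRingHom (fun w' : PlacesOver L v => w'.1.adicCompletion L) w))).trace - 2) < 1) (hdet : Valued.v ((((γH.1.val : GL (Fin 2) (UnitaryGroup.LocalRing L v)).val.map (Pi.evalRingHom (fun w' : PlacesOver L v => w'.1.adicCompletion L) w))).det - 1) < 1)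
    (χdec : ∀ h : ((cmDatum L 2 (Matrix.of fun i j : Fin 2 => if i.val + j.val + 1 = 2 then (1 : L) else 0)).Local v × (cmDatum L 1 (Matrix.of fun i j : Fin 1 => if i.val + j.val + 1 = 1 then (1 : L) else 0)).Local v), Decidable ((redMat (((h.1.val : GL (Fin 2) (UnitaryGroup.LocalRing L v)).val.map (Pi.evalRingHom (fun w' : PlacesOver L v => w'.1.adicCompletion L) w))) - 1) ^ 2 = 0 ∧ (redMat (((h.1.val : GL (Fin 2) (UnitaryGroup.LocalRing L v)).val.map (Pi.evalRingHom (fun w' : PlacesOver L v => w'.1.adicCompletion L) w))) - 1).rank = 0)) :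
    stableOrbitalIntegralRel (IsLocalStablyConjH L v) mH ((((cmLocalIntegralLevel L 2 (Matrix.of fun i j : Fin 2 => if i.val + j.val + 1 = 2 then (1 : L) else 0) v).prod (cmLocalIntegralLevel L 1 (Matrix.of fun i j : Fin 1 => if i.val + j.val + 1 = 1 then (1 : L) else 0) v) : Subgroup ((cmDatum L 2 (Matrix.of fun i j : Fin 2 => if i.val + j.val + 1 = 2 then (1 : L) else 0)).Local v × (cmDatum L 1 (Matrix.of fun i j : Fin 1 => if i.val + j.val + 1 = 1 then (1 : L) else 0)).Local v)) : Set ((cmDatum L 2 (Matrix.of fun i j : Fin 2 => if i.val + j.val + 1 = 2 then (1 : L) else 0)).Local v × (cmDatum L 1 (Matrix.of fun i j : Fin 1 => if i.val + j.val + 1 = 1 then (1 : L) else 0)).Local v)).indicator (fun h : ((cmDatum L 2 (Matrix.of fun i j : Fin 2 => if i.val + j.val + 1 = 2 then (1 : L) else 0)).Local v × (cmDatum L 1 (Matrix.of fun i j : Fin 1 => if i.val + j.val + 1 = 1 then (1 : L) else 0)).Local v) => if (redMat (((h.1.val : GL (Fin 2) (UnitaryGroup.LocalRing L v)).val.map (Pi.evalRingHom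 (fun w' : PlacesOver L v => w'.1.adicCompletion L) w))) - 1) ^ 2 = 0 ∧ (redMat (((h.1.val : GL (Fin 2) (UnitaryGroup.LocalRing L v)).val.map (Pi.evalRingHom (fun w' : PlacesOver L v => w'.1.adicCompletion L) w))) - 1).rank = 0 then (1 : ℂ) else 0)) γH =
      (νH.real (((cmLocalIntegralLevel L 2 (Matrix.of fun i j : Fin 2 => if i.val + j.val + 1 = 2 then (1 : L) else 0) v).prod (cmLocalIntegralLevel L 1 (Matrix.of fun i j : Fin 1 => if i.val + j.val + 1 = 1 then (1 : L) else 0) v) : Subgroup ((cmDatum L 2 (Matrix.of fun i j : Fin 2 => if i.val + j.val + 1 = 2 then (1 : L) else 0)).Local v × (cmDatum L 1 (Matrix.of fun i j : Fin 1 => if i.val + j.val + 1 = 1 then (1 : L) else 0)).Local v)) : Set ((cmDatum L 2 (Matrix.of fun i j : Fin 2 => if i.val + j.val + 1 = 2 then (1 : L) else 0)).Local v × (cmDatum L 1 (Matrix.of fun i j : Fin 1 => if i.val + j.val + 1 = 1 then (1 : L) else 0)).Local v)) : ℂ) * (Nat.card (fixedBy (((cmDatum L 2 (Matrix.of fun i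 j : Fin 2 => if i.val + j.val + 1 = 2 then (1 : L) else 0)).Local v) ⧸ (cmLocalIntegralLevel L 2 (Matrix.of fun i j : Fin 2 => if i.val + j.val + 1 = 2 then (1 : L) else 0) v)) γH.1) : ℂ) := by
  have hK1 : cmLocalIntegralLevel L 1 (Matrix.of fun i j : Fin 1 => if i.val + j.val + 1 = 1 then (1 : L) else 0) v = ⊤ :=
    cmLocalIntegralLevel_one_eq_top_of_smul_eq L _ w hw (isUnit_placeForm_antidiagOne (E := L) 1 w.1)
  -- `χ⁰ = 1_{K_H}` on the stable orbit of the deep `γ_H`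
  have hcongr : stableOrbitalIntegralRel (IsLocalStablyConjH L v) mH ((((cmLocalIntegralLevel L 2 (Matrix.of fun i j : Fin 2 => if i.val + j.val + 1 = 2 then (1 : L) else 0) v).prod (cmLocalIntegralLevel L 1 (Matrix.of fun i j : Fin 1 => if i.val + j.val + 1 = 1 then (1 : L) else 0) v) : Subgroup ((cmDatum L 2 (Matrix.of fun i j : Fin 2 => if i.val + j.val + 1 = 2 then (1 : L) else 0)).Local v × (cmDatum L 1 (Matrix.of fun i j : Fin 1 => if i.val + j.val + 1 = 1 then (1 : L) else 0)).Local v)) : Set ((cmDatum L 2 (Matrix.of fun i j : Fin 2 => if i.val + j.val + 1 = 2 then (1 : L) else 0)).Local v × (cmDatum L 1 (Matrix.of fun i j : Fin 1 => if i.val + j.val + 1 = 1 then (1 : L) else 0)).Local v)).indicator (fun h : ((cmDatum L 2 (Matrix.of fun i j : Fin 2 => if i.val + j.val + 1 = 2 then (1 : L) else 0)).Local v × (cmDatum L 1 (Matrix.of fun i j : Fin 1 => if i.val + j.val + 1 = 1 then (1 : L) else 0)).Local v) => if (redMat (((h.1.val : GL (Fin 2) (UnitaryGroup.LocalRing L v)).val.map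 (Pi.evalRingHom (fun w' : PlacesOver L v => w'.1.adicCompletion L) w))) - 1) ^ 2 = 0 ∧ (redMat (((h.1.val : GL (Fin 2) (UnitaryGroup.LocalRing L v)).val.map (Pi.evalRingHom (fun w' : PlacesOver L v => w'.1.adicCompletion L) w))) - 1).rank = 0 then (1 : ℂ) else 0)) γH =
      stableOrbitalIntegralRel (IsLocalStablyConjH L v) mH ((((cmLocalIntegralLevel L 2 (Matrix.of fun i j : Fin 2 => if i.val + j.val + 1 = 2 then (1 : L) else 0) v).prod (cmLocalIntegralLevel L 1 (Matrix.of fun i j : Fin 1 => if i.val + j.val + 1 = 1 then (1 : L) else 0) v) : Subgroup ((cmDatum L 2 (Matrix.of fun i j : Fin 2 => if i.val + j.val + 1 = 2 then (1 : L) else 0)).Local v × (cmDatum L 1 (Matrix.of fun i j : Fin 1 => if i.val + j.val + 1 = 1 then (1 : L) else 0)).Local v)) : Set ((cmDatum L 2 (Matrix.of fun i j : Fin 2 => if i.val + j.val + 1 = 2 then (1 : L) else 0)).Local v × (cmDatum L 1 (Matrix.of fun i j : Fin 1 => if i.val + j.val + 1 = 1 then (1 : L) else 0)).Local v)).indicator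 fun _ => (1 : ℂ)) γH := by
    refine stableOrbitalIntegralRel_congr_fun_of_eqOn mH
      {x : ((cmDatum L 2 (Matrix.of fun i j : Fin 2 => if i.val + j.val + 1 = 2 then (1 : L) else 0)).Local v × (cmDatum L 1 (Matrix.of fun i j : Fin 1 => if i.val + j.val + 1 = 1 then (1 : L) else 0)).Local v) | x ∈ (((cmLocalIntegralLevel L 2 (Matrix.of fun i j : Fin 2 => if i.val + j.val + 1 = 2 then (1 : L) else 0) v).prod (cmLocalIntegralLevel L 1 (Matrix.of fun i j : Fin 1 => if i.val + j.val + 1 = 1 then (1 : L) else 0) v) : Subgroup ((cmDatum L 2 (Matrix.of fun i j : Fin 2 => if i.val + j.val + 1 = 2 then (1 : L) else 0)).Local v × (cmDatum L 1 (Matrix.of fun i j : Fin 1 => if i.val + j.val + 1 = 1 then (1 : L) else 0)).Local v)) : Set ((cmDatum L 2 (Matrix.of fun i j : Fin 2 => if i.val + j.val + 1 = 2 then (1 : L) else 0)).Local v × (cmDatum L 1 (Matrix.of fun i j : Fin 1 => if i.val + j.val + 1 = 1 then (1 : L) else 0)).Local v)) → redMat (((x.1.val : GL (Fin 2) (UnitaryGroup.LocalRing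 L v)).val.map (Pi.evalRingHom (fun w' : PlacesOver L v => w'.1.adicCompletion L) w))) = 1} ?_ ?_
    · intro b hb y hyK
      exact redMat_eq_one_of_sq_sub_one_eq_zero_of_ramified L v w hw he h2 _ hyK
        (sq_redMat_sub_one_eq_zero_of_isLocalStablyConjH_of_trace_of_det L v w hw htr hdet hb y hyK)
    · intro x hx
      by_cases hxK : x ∈ (((cmLocalIntegralLevel L 2 (Matrix.of fun i j : Fin 2 => if i.val + j.val + 1 = 2 then (1 : L) else 0) v).prod (cmLocalIntegralLevel L 1 (Matrix.of fun i j : Fin 1 => if i.val + j.val + 1 = 1 then (1 : L) else 0) v) : Subgroup ((cmDatum L 2 (Matrix.of fun i j : Fin 2 => if i.val + j.val + 1 = 2 then (1 : L) else 0)).Local v × (cmDatum L 1 (Matrix.of fun i j : Fin 1 => if i.val + j.val + 1 = 1 then (1 : L) else 0)).Local v)) : Set ((cmDatum L 2 (Matrix.of fun i j : Fin 2 => if i.val + j.val + 1 = 2 then (1 : L) else 0)).Local v × (cmDatum L 1 (Matrix.of fun i j : Fin 1 => if i.val + j.val + 1 = 1 then (1 : L) else 0)).Local v))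
      · have hr := hx hxK
        rw [Set.indicator_of_mem hxK, Set.indicator_of_mem hxK, if_pos]
        exact ⟨by rw [hr, sub_self, zero_pow two_ne_zero], by rw [hr, sub_self, Matrix.rank_zero]⟩
      · rw [Set.indicator_of_notMem hxK, Set.indicator_of_notMem hxK]
  rw [hcongr, hK1]
  have hK2 := isCompact_isOpen_cmLocalIntegralLevel L 2 (Matrix.of fun i j : Fin 2 => if i.val + j.val + 1 = 2 then (1 : L) else 0) v
  exact stableOrbitalIntegralRel_indicator_prod_top_eq_mul_natCard_fixedBy_of_not_exists_isRoot L v w hw νH hmH _ hK2.2 hK2.1 hreg hirr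

end HValues

/-! ## §3 The counts: transport to the one-place model `U_w` and ★ p847070 -/

section Counts

variable (L : Type) [Field L] [NumberField L] [IsCMField L] (v : HeightOneSpectrum (𝓞 ↥(maximalRealSubfield L)))
  (w : PlacesOver L v) (hw : IsCMField.complexConj L • w.1 = w.1)

/-- **TRANSPORT TO `U_w`**: for `C′ ≤ U₂` matched by `E₂` with `D_η GL₂(𝒪_w) D_η⁻¹`, `#Fix_{γ₂}(U₂ ⧸ C′) = #Fix_{E₂ γ₂}(U_w ⧸ K♯_η)` (`K♯_η` pulled back along `U_w ≤ GL₂(L_w)`;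
★ `natCard_fixedBy_quotient_congr`; `Set.ncard` on the right as in ★ p847070). [cite: Kottwitz1988, §2] [cite: Serre1980Trees, Ch. I §6.1] -/
theorem natCard_fixedBy_eq_ncard_fixedBy_onePlace (η : (w.1.adicCompletion L)ˣ) (C' : Subgroup ((cmDatum L 2 (Matrix.of fun i j : Fin 2 => if i.val + j.val + 1 = 2 then (1 : L) else 0)).Local v))
    (hC' : ∀ g, g ∈ C' ↔ (((localNonsplitEquiv (IsCMField.complexConj L) (Matrix.of fun i j : Fin 2 => if i.val + j.val + 1 = 2 then (1 : L) else 0) (IsCMField.complexConj_ne_one L) w hw) g : ↥(unitaryGroupOfForm (galAdicCompletionMap (L := L) (IsCMField.complexConj L) hw) (placeForm (Matrix.of fun i j : Fin 2 => if i.val + j.val + 1 = 2 then (1 : L) else 0) w.1))) : GL (Fin 2) (w.1.adicCompletion L)) ∈ (glInt 2 (w.1.adicCompletion L)).map (MulAut.conj (glDiagonal 2 (w.1.adicCompletion L) ![1, η])).toMonoidHom)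
    (γ₂ : ((cmDatum L 2 (Matrix.of fun i j : Fin 2 => if i.val + j.val + 1 = 2 then (1 : L) else 0)).Local v)) :
    Nat.card (fixedBy (((cmDatum L 2 (Matrix.of fun i j : Fin 2 => if i.val + j.val + 1 = 2 then (1 : L) else 0)).Local v) ⧸ C') γ₂) = (fixedBy (↥(unitaryGroupOfForm (galAdicCompletionMap (L := L) (IsCMField.complexConj L) hw) (placeForm (Matrix.of fun i j : Fin 2 => if i.val + j.val + 1 = 2 then (1 : L) else 0) w.1)) ⧸ (((glInt 2 (w.1.adicCompletion L)).map (MulAut.conj (glDiagonal 2 (w.1.adicCompletion L) ![1, η])).toMonoidHom).comap (unitaryGroupOfForm (galAdicCompletionMap (L := L) (IsCMField.complexConj L) hw) (placeForm (Matrix.of fun i j : Fin 2 => if i.val + j.val + 1 = 2 then (1 : L) else 0) w.1)).subtype)) ((localNonsplitEquiv (IsCMField.complexConj L) (Matrix.of fun i j : Fin 2 => if i.val + j.val + 1 = 2 then (1 : L) else 0) (IsCMField.complexConj_ne_one L) w hw) γ₂)).ncard := by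
  rw [← Nat.card_coe_set_eq]
  exact natCard_fixedBy_quotient_congr C' _ (localNonsplitEquiv (IsCMField.complexConj L) (Matrix.of fun i j : Fin 2 => if i.val + j.val + 1 = 2 then (1 : L) else 0) (IsCMField.complexConj_ne_one L) w hw).toMulEquiv
    (fun g => by rw [hC' g, Subgroup.mem_comap, Subgroup.coe_subtype]; rfl) γ₂

include hw in
/-- **THE `K♯`-COLUMN COUNT AT DEPTH `2n` (unramified-elliptic descent), read on `U₂`**: `(q − 1)·#Fix_{γ₂}(U₂ ⧸ C′) + 2 = (q + 1)·qⁿ`, `q = #(𝓞_{L⁺} ∕ v)` — ★ p847070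
`ncard_fixedBy_quotient_comap_modular_of_unramified_elliptic` through §3's transport; hypotheses = its descent datum `(s, g)` of `E₂ γ₂` for the anti-fixed uniformiser `η`
and the discriminant data `t² − 4d = ε₀ z²`, `|z∕t| = |ϖ_F|ⁿ`. [cite: LabesseLanglands1979, §2 p. 8] [cite: Kottwitz1988, §2] [cite: Tits1979, §3.9] -/
theorem sub_one_mul_natCard_fixedBy_add_two_eq_of_unramified_elliptic (he : v.asIdeal.ramificationIdx' w.1.asIdeal ≠ 1)
    (η : (w.1.adicCompletion L)ˣ) (hη : Valued.v (η : w.1.adicCompletion L) = WithZero.exp (-1 : ℤ))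
    (hση : galAdicCompletionMap (L := L) (IsCMField.complexConj L) hw (η : w.1.adicCompletion L) = -(η : w.1.adicCompletion L))
    {ϖF : v.adicCompletion ↥(maximalRealSubfield L)} (hϖF : Valued.v ϖF = WithZero.exp (-1 : ℤ))
    (C' : Subgroup ((cmDatum L 2 (Matrix.of fun i j : Fin 2 => if i.val + j.val + 1 = 2 then (1 : L) else 0)).Local v))
    (hC' : ∀ g, g ∈ C' ↔ (((localNonsplitEquiv (IsCMField.complexConj L) (Matrix.of fun i j : Fin 2 => if i.val + j.val + 1 = 2 then (1 : L) else 0) (IsCMField.complexConj_ne_one L) w hw) g : ↥(unitaryGroupOfForm (galAdicCompletionMap (L := L) (IsCMField.complexConj L) hw) (placeForm (Matrix.of fun i j : Fin 2 => if i.val + j.val + 1 = 2 then (1 : L) else 0) w.1))) : GL (Fin 2) (w.1.adicCompletion L)) ∈ (glInt 2 (w.1.adicCompletion L)).map (MulAut.conj (glDiagonal 2 (w.1.adicCompletion L) ![1, η])).toMonoidHom)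
    (γ₂ : ((cmDatum L 2 (Matrix.of fun i j : Fin 2 => if i.val + j.val + 1 = 2 then (1 : L) else 0)).Local v)) {s : w.1.adicCompletion L} {g : GL (Fin 2) (v.adicCompletion ↥(maximalRealSubfield L))} (hs : s ≠ 0)
    (hsg : Matrix.diagonal ![1, (η : w.1.adicCompletion L)] * ((((localNonsplitEquiv (IsCMField.complexConj L) (Matrix.of fun i j : Fin 2 => if i.val + j.val + 1 = 2 then (1 : L) else 0) (IsCMField.complexConj_ne_one L) w hw) γ₂ : ↥(unitaryGroupOfForm (galAdicCompletionMap (L := L) (IsCMField.complexConj L) hw) (placeForm (Matrix.of fun i j : Fin 2 => if i.val + j.val + 1 = 2 then (1 : L) else 0) w.1))) : GL (Fin 2) (w.1.adicCompletion L)) : Matrix (Fin 2) (Fin 2) (w.1.adicCompletion L)) * Matrix.diagonal ![1, (η : w.1.adicCompletion L)⁻¹] =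
      s • (g : Matrix (Fin 2) (Fin 2) (v.adicCompletion ↥(maximalRealSubfield L))).map (toPlace v w))
    (h2 : (2 : v.adicCompletion ↥(maximalRealSubfield L)) ≠ 0)
    {ε₀ : v.adicCompletion ↥(maximalRealSubfield L)} (hε₀ : ε₀ ∈ 𝒪[v.adicCompletion ↥(maximalRealSubfield L)])
    (hns : ∀ b : v.adicCompletion ↥(maximalRealSubfield L), b ∈ 𝒪[v.adicCompletion ↥(maximalRealSubfield L)] → valuation _ (b ^ 2 - ε₀) = 1)
    {t d z : v.adicCompletion ↥(maximalRealSubfield L)}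
    (htr : (g : Matrix (Fin 2) (Fin 2) (v.adicCompletion ↥(maximalRealSubfield L))).trace = t) (hdet : (g : Matrix (Fin 2) (Fin 2) (v.adicCompletion ↥(maximalRealSubfield L))).det = d)
    (ht : t ≠ 0) (hz : z ≠ 0) (hD : t ^ 2 - 4 * d = ε₀ * z ^ 2) {n : ℕ}
    (hn : valuation (v.adicCompletion ↥(maximalRealSubfield L)) (z * t⁻¹) = valuation (v.adicCompletion ↥(maximalRealSubfield L)) ϖF ^ n) :
    (Nat.card (𝓞 ↥(maximalRealSubfield L) ⧸ v.asIdeal) - 1) * Nat.card (fixedBy (((cmDatum L 2 (Matrix.of fun i j : Fin 2 => if i.val + j.val + 1 = 2 then (1 : L) else 0)).Local v) ⧸ C') γ₂) + 2 =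
      (Nat.card (𝓞 ↥(maximalRealSubfield L) ⧸ v.asIdeal) + 1) * Nat.card (𝓞 ↥(maximalRealSubfield L) ⧸ v.asIdeal) ^ n := by
  haveI := finite_residueField_integer_adicCompletion L v
  rw [← natCard_residueField_integer_adicCompletion_eq L v, natCard_fixedBy_eq_ncard_fixedBy_onePlace L v w hw η C' hC' γ₂]
  exact ncard_fixedBy_quotient_comap_modular_of_unramified_elliptic L v w hw hση η.ne_zero hϖF he hη η hη _ hs hsg h2 hε₀ hns htr hdet ht hz hD hn

include hw in
/-- **THE `K♯`-COLUMN COUNT AT DEPTH `2n + 1` (ramified-elliptic descent), read on `U₂`**: `(q − 1)·#Fix_{γ₂}(U₂ ⧸ C′) + 2 = 2·q^(n+1)` — ★ p847070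
`ncard_fixedBy_quotient_comap_modular_of_ramified_elliptic` through §3's transport (`t² − 4d = π₁ z²`, `|π₁| = |ϖ_F|`, `|z∕t| = |ϖ_F|ⁿ`).
[cite: LabesseLanglands1979, §2 p. 8] [cite: Kottwitz1988, §2] [cite: Tits1979, §3.9] -/
theorem sub_one_mul_natCard_fixedBy_add_two_eq_of_ramified_elliptic (he : v.asIdeal.ramificationIdx' w.1.asIdeal ≠ 1)
    (η : (w.1.adicCompletion L)ˣ) (hη : Valued.v (η : w.1.adicCompletion L) = WithZero.exp (-1 : ℤ))
    (hση : galAdicCompletionMap (L := L) (IsCMField.complexConj L) hw (η : w.1.adicCompletion L) = -(η : w.1.adicCompletion L))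
    {ϖF : v.adicCompletion ↥(maximalRealSubfield L)} (hϖF : Valued.v ϖF = WithZero.exp (-1 : ℤ))
    (C' : Subgroup ((cmDatum L 2 (Matrix.of fun i j : Fin 2 => if i.val + j.val + 1 = 2 then (1 : L) else 0)).Local v))
    (hC' : ∀ g, g ∈ C' ↔ (((localNonsplitEquiv (IsCMField.complexConj L) (Matrix.of fun i j : Fin 2 => if i.val + j.val + 1 = 2 then (1 : L) else 0) (IsCMField.complexConj_ne_one L) w hw) g : ↥(unitaryGroupOfForm (galAdicCompletionMap (L := L) (IsCMField.complexConj L) hw) (placeForm (Matrix.of fun i j : Fin 2 => if i.val + j.val + 1 = 2 then (1 : L) else 0) w.1))) : GL (Fin 2) (w.1.adicCompletion L)) ∈ (glInt 2 (w.1.adicCompletion L)).map (MulAut.conj (glDiagonal 2 (w.1.adicCompletion L) ![1, η])).toMonoidHom)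
    (γ₂ : ((cmDatum L 2 (Matrix.of fun i j : Fin 2 => if i.val + j.val + 1 = 2 then (1 : L) else 0)).Local v)) {s : w.1.adicCompletion L} {g : GL (Fin 2) (v.adicCompletion ↥(maximalRealSubfield L))} (hs : s ≠ 0)
    (hsg : Matrix.diagonal ![1, (η : w.1.adicCompletion L)] * ((((localNonsplitEquiv (IsCMField.complexConj L) (Matrix.of fun i j : Fin 2 => if i.val + j.val + 1 = 2 then (1 : L) else 0) (IsCMField.complexConj_ne_one L) w hw) γ₂ : ↥(unitaryGroupOfForm (galAdicCompletionMap (L := L) (IsCMField.complexConj L) hw) (placeForm (Matrix.of fun i j : Fin 2 => if i.val + j.val + 1 = 2 then (1 : L) else 0) w.1))) : GL (Fin 2) (w.1.adicCompletion L)) : Matrix (Fin 2) (Fin 2) (w.1.adicCompletion L)) * Matrix.diagonal ![1, (η : w.1.adicCompletion L)⁻¹] =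
      s • (g : Matrix (Fin 2) (Fin 2) (v.adicCompletion ↥(maximalRealSubfield L))).map (toPlace v w))
    (h2 : (2 : v.adicCompletion ↥(maximalRealSubfield L)) ≠ 0)
    {π₁ : v.adicCompletion ↥(maximalRealSubfield L)} (hπ₁ : valuation (v.adicCompletion ↥(maximalRealSubfield L)) π₁ = valuation _ ϖF)
    {t d z : v.adicCompletion ↥(maximalRealSubfield L)}
    (htr : (g : Matrix (Fin 2) (Fin 2) (v.adicCompletion ↥(maximalRealSubfield L))).trace = t) (hdet : (g : Matrix (Fin 2) (Fin 2) (v.adicCompletion ↥(maximalRealSubfield L))).det = d)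
    (ht : t ≠ 0) (hz : z ≠ 0) (hD : t ^ 2 - 4 * d = π₁ * z ^ 2) {n : ℕ}
    (hn : valuation (v.adicCompletion ↥(maximalRealSubfield L)) (z * t⁻¹) = valuation (v.adicCompletion ↥(maximalRealSubfield L)) ϖF ^ n) :
    (Nat.card (𝓞 ↥(maximalRealSubfield L) ⧸ v.asIdeal) - 1) * Nat.card (fixedBy (((cmDatum L 2 (Matrix.of fun i j : Fin 2 => if i.val + j.val + 1 = 2 then (1 : L) else 0)).Local v) ⧸ C') γ₂) + 2 =
      2 * Nat.card (𝓞 ↥(maximalRealSubfield L) ⧸ v.asIdeal) ^ (n + 1) := by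
  haveI := finite_residueField_integer_adicCompletion L v
  rw [← natCard_residueField_integer_adicCompletion_eq L v, natCard_fixedBy_eq_ncard_fixedBy_onePlace L v w hw η C' hC' γ₂]
  exact ncard_fixedBy_quotient_comap_modular_of_ramified_elliptic L v w hw hση η.ne_zero hϖF he hη η hη _ hs hsg h2 hπ₁ htr hdet ht hz hD hn

end Counts

end Literature.NumberTheory.Automorphic.UnitaryGroup

end
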